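import Literature.GroupTheory.CombinatorialGroupTheory.FreeGroupPowerWords
import HarnessLib

/-!
# Big powers in free groups, II: Baumslag's two-sided cancellation bound and the normal form

Topic `Literature/GroupTheory/CombinatorialGroupTheory`; theorems only; part II of the big powers
lemma (G. Baumslag, Math. Z. 78 (1962), Prop. 1), over `FreeGroupPowerWords.lean` and the tree's
`NielsenCancellation.lean`.

* `rotate_eq_and_eq_of_le_cancelAux` — reading off the cancelled segments: if `Vᵃ` (reversed)
  cancels at least `|P| + ℓ` letters of `P ++ V'ⁿ` (`|V'| = |V| = ℓ`), then the first copy of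
  `V'` is the rotation by `|P| mod ℓ` of `V⁻¹`, and `P = (V⁻¹)^q ++ (V⁻¹).take r` (`|P| = qℓ + r`);
* `maxCancel_lt` — **the cancellation bound**: for `V = v.toWord` cyclically reduced and
  `P = (g v'ᵇ).toWord`, fewer than `|P| + ℓ` letters cancel between `Vᵃ` and `P ++ V'ⁿ` when
  `v' = v` (else `v` would be conjugate to `v⁻¹`) or when `v' = v⁻¹` and `g ∉ C(v)` (else `g`
  would commute with `v`);
* `exists_toWord_pow_mul_mul_pow` — **the normal form**: there are `A, B ≥ 1` and a fixed word `C`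
  with `(vˣ g v'ʸ).toWord = V^(x-A+1) ++ C ++ V'^(y-B+1)` for all `x ≥ A`, `y ≥ B`;
* the engine of part III: `toWord_step` (no cancellation reaches past the current power block),
  `exists_toWord_mul_pow` (base), `mul_ne_one_of_toWord` (a long block survives a final bounded
  factor), and the integer-power bookkeeping `zpow_eq_pow_natAbs` / `_of_nonneg` / `_of_neg`.

## References
* G. Baumslag, *On generalised free products*, Math. Z. 78 (1962) 423–438, Prop. 1 (text not held, acq-11105; locator per the tree bib entry). [Baumslag1962]
* R. C. Lyndon, P. E. Schupp, *Combinatorial Group Theory*, Ch. I §2. [LyndonSchupp2001]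
-/

namespace Literature.GroupTheory.CombinatorialGroupTheory

open List

universe u

namespace FreeGroupBigPowers

variable {α : Type u}

/-- Inverting the letters twice is the identity. [folklore] -/
private theorem map_inv_map_inv (L : List (α × Bool)) :
    (L.map fun x : α × Bool => (x.1, !x.2)).map (fun x : α × Bool => (x.1, !x.2)) = L := by
  rw [map_map]
  convert map_id L
  funext x
  simp

/-- `invRev L` is the letterwise inverse of `L.reverse`. [folklore] -/
private theorem reverse_map_inv (L : List (α × Bool)) :
    L.reverse.map (fun x : α × Bool => (x.1, !x.2)) = FreeGroup.invRev L := by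
  rw [FreeGroup.invRev, map_reverse]

variable [DecidableEq α]

/-- **The cancelled segments, read off.**  Let `R = (Vᵃ).reverse` face the word
`W = P ++ V'ⁿ` (`|V'| = |V| = ℓ ≥ 1`, `n ≥ 1`, `aℓ ≥ |P| + ℓ`).  If at least `|P| + ℓ` letters
cancel, then (i) the first copy of `V'` is the rotation by `|P| mod ℓ` of `V⁻¹ = invRev V`, and
(ii) `P` itself is a prefix of the power word of `V⁻¹`: `P = (V⁻¹)^q ++ (V⁻¹).take r`,
`|P| = qℓ + r`. [cite: LyndonSchupp2001, Ch. I §2] -/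
theorem rotate_eq_and_eq_of_le_cancelAux (V V' P : List (α × Bool)) (a n : ℕ)
    (hℓ : 0 < V.length) (hV' : V'.length = V.length) (hn : 1 ≤ n)
    (ha : P.length + V.length ≤ a * V.length)
    (hj : P.length + V.length ≤
      cancelAux (replicate a V.reverse).flatten (P ++ (replicate n V').flatten)) :
    (FreeGroup.invRev V).rotate (P.length % V.length) = V' ∧
      P = (replicate (P.length / V.length) (FreeGroup.invRev V)).flatten ++
        (FreeGroup.invRev V).take (P.length % V.length) := by
  set R := (replicate a V.reverse).flatten with hR
  set W := P ++ (replicate n V').flatten with hW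
  set j := cancelAux R W with hjdef
  have key := take_cancelAux_eq_map R W
  rw [← hjdef] at key
  have hℓ' : V.reverse.length = V.length := length_reverse
  constructor
  · -- (i): the window `[|P|, |P| + ℓ)`
    have e := congrArg (fun l : List (α × Bool) => (l.drop P.length).take V.length) key
    rw [drop_take, take_take, Nat.min_eq_left (by omega), ← map_drop, ← map_take, drop_take,
      take_take, Nat.min_eq_left (by omega), hW, drop_left, hR] at e
    have h3 := take_drop_flatten_replicate V.reverse a P.length (by rw [hℓ']; exact ha)
    rw [hℓ'] at h3
    rw [h3] at e
    obtain ⟨m, rfl⟩ : ∃ m, n = m + 1 := ⟨n - 1, by omega⟩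
    rw [replicate_succ, flatten_cons, take_left' hV'] at e
    -- `e : V.reverse.rotate t = V'.map inv`; apply `map inv`
    have e' := congrArg (List.map fun x : α × Bool => (x.1, !x.2)) e
    simp only [map_rotate] at e'
    rw [reverse_map_inv, map_inv_map_inv] at e'
    exact e'
  · -- (ii): the prefix of length `|P|`
    have e := congrArg (fun l : List (α × Bool) => l.take P.length) key
    rw [take_take, Nat.min_eq_left (by omega), ← map_take, take_take, Nat.min_eq_left (by omega),
      hW, take_left, hR] at e
    have hdm : P.length = P.length / V.length * V.length + P.length % V.length := by
      rw [Nat.mul_comm]; exact (Nat.div_add_mod _ _).symm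
    have hq : P.length / V.length < a := by
      rw [Nat.div_lt_iff_lt_mul hℓ]; omega
    rw [hdm, ← hℓ', take_flatten_replicate V.reverse a _ _ (by rwa [hℓ']) (by rw [hℓ']; exact
      (Nat.mod_lt _ hℓ).le), hℓ'] at e
    have e' := congrArg (List.map fun x : α × Bool => (x.1, !x.2)) e
    rw [map_inv_map_inv, map_append, map_flatten_replicate, reverse_map_inv, map_take,
      reverse_map_inv] at e'
    exact e'.symm


/-! ### The two-sided cancellation bound -/

section Depth

variable {v : FreeGroup α}

/-- **Baumslag's cancellation bound.**  Let `V = v.toWord` be cyclically reduced, `v ≠ 1`, and let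
`v' = v`, or `v' = v⁻¹` with `g ∉ C(v)`.  If `P = (g v'ᵇ).toWord` and `aℓ ≥ |P| + ℓ` (`ℓ = |V|`), then
fewer than `|P| + ℓ` letters cancel between `Vᵃ` and `P ++ V'ⁿ` (`n ≥ 1`): otherwise a full copy of
`V'` would cancel against a rotation of `V`, forcing `v` to be conjugate to `v⁻¹` (same sign) or
`g` to commute with `v` (opposite signs). [cite: Baumslag1962, Prop. 1] -/
theorem maxCancel_lt (hv : FreeGroup.IsCyclicallyReduced v.toWord) (hv1 : v ≠ 1)
    {g v' : FreeGroup α} (hv' : v' = v ∨ (v' = v⁻¹ ∧ ¬ Commute g v)) {b : ℕ}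
    {P : List (α × Bool)} (hP : (g * v' ^ b).toWord = P) {a n : ℕ} (hn : 1 ≤ n)
    (ha : P.length + v.toWord.length ≤ a * v.toWord.length) :
    maxCancel (v ^ a).toWord (P ++ (replicate n v'.toWord).flatten) <
      P.length + v.toWord.length := by
  by_contra hge
  push Not at hge
  have hℓ : 0 < v.toWord.length := by
    rw [length_pos_iff]; exact fun e => hv1 (FreeGroup.toWord_eq_nil_iff.mp e)
  have hV' : v'.toWord.length = v.toWord.length := by
    rcases hv' with rfl | ⟨rfl, -⟩
    · rfl
    · rw [FreeGroup.toWord_inv, FreeGroup.invRev_length]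
  have hR : (v ^ a).toWord.reverse = (replicate a v.toWord.reverse).flatten := by
    rw [toWord_pow_of_isCyclicallyReduced hv, reverse_flatten_replicate]
  unfold maxCancel at hge
  rw [hR] at hge
  obtain ⟨hrot, hPeq⟩ :=
    rotate_eq_and_eq_of_le_cancelAux v.toWord v'.toWord P a n hℓ hV' hn ha hge
  have ht : P.length % v.toWord.length ≤ (FreeGroup.invRev v.toWord).length := by
    rw [FreeGroup.invRev_length]; exact (Nat.mod_lt _ hℓ).le
  have hmkinv : FreeGroup.mk (FreeGroup.invRev v.toWord) = v⁻¹ := by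
    rw [← FreeGroup.inv_mk, FreeGroup.mk_toWord]
  rcases hv' with rfl | ⟨rfl, hg⟩
  · -- same sign: `v⁻¹` is conjugate to `v`
    have e := congrArg FreeGroup.mk hrot
    rw [mk_rotate _ ht, hmkinv, FreeGroup.mk_toWord] at e
    have h1 : v'⁻¹ = 1 := eq_one_of_conj_eq_inv (by rw [e, inv_inv])
    exact hv1 (inv_eq_one.mp h1)
  · -- opposite signs: `g` commutes with `v`
    rw [FreeGroup.toWord_inv] at hrot
    have hc : Commute (FreeGroup.mk ((FreeGroup.invRev v.toWord).take
        (P.length % v.toWord.length))) v⁻¹ := by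
      have := commute_mk_take_of_rotate_eq ht hrot
      rwa [hmkinv] at this
    have hPmk : FreeGroup.mk P = v⁻¹ ^ (P.length / v.toWord.length) *
        FreeGroup.mk ((FreeGroup.invRev v.toWord).take (P.length % v.toWord.length)) := by
      conv_lhs => rw [hPeq]
      rw [← FreeGroup.mul_mk, mk_flatten_replicate, hmkinv]
    have hgP : g = FreeGroup.mk P * (v⁻¹ ^ b)⁻¹ := by
      rw [← hP, FreeGroup.mk_toWord, mul_inv_cancel_right]
    apply hg
    rw [← Commute.inv_right_iff, hgP, hPmk]
    exact ((Commute.pow_left (Commute.refl v⁻¹) _).mul_left hc).mul_left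
      (Commute.pow_left (Commute.refl v⁻¹) b).inv_left

end Depth

/-! ### The core lemma: a reduced normal form for `vˣ g v'ʸ` -/

section Core

variable {v : FreeGroup α}

/-- `(replicate (m+1) L).flatten = (replicate m L).flatten ++ L`. [cite: LyndonSchupp2001, Ch. I §2] -/
theorem flatten_replicate_succ' {β : Type*} (L : List β) (m : ℕ) :
    (replicate (m + 1) L).flatten = (replicate m L).flatten ++ L := by
  rw [replicate_succ', flatten_append, flatten_singleton]

/-- **Core lemma (two-sided normal form).**  For `V = v.toWord` cyclically reduced, `v ≠ 1`, and
`v' = v` or (`v' = v⁻¹` and `g ∉ C(v)`): there are `A, B` and a fixed middle word `C` such that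
for all `x ≥ A`, `y ≥ B` the reduced word of `vˣ g v'ʸ` is `V^(x-A+1) ++ C ++ V'^(y-B+1)` — all
but boundedly many of the letters of the two powers survive. [cite: Baumslag1962, Prop. 1] -/
theorem exists_toWord_pow_mul_mul_pow (hv : FreeGroup.IsCyclicallyReduced v.toWord) (hv1 : v ≠ 1)
    (g v' : FreeGroup α) (hv' : v' = v ∨ (v' = v⁻¹ ∧ ¬ Commute g v)) :
    ∃ (A B : ℕ) (C : List (α × Bool)), 1 ≤ A ∧ 1 ≤ B ∧ ∀ x y : ℕ, A ≤ x → B ≤ y →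
      (v ^ x * g * v' ^ y).toWord = (replicate (x - A + 1) v.toWord).flatten ++ C ++
        (replicate (y - B + 1) v'.toWord).flatten := by
  have hv'cr : FreeGroup.IsCyclicallyReduced v'.toWord := by
    rcases hv' with rfl | ⟨rfl, -⟩
    · exact hv
    · rw [FreeGroup.toWord_inv]; exact isCyclicallyReduced_invRev hv
  have hv'1 : v' ≠ 1 := by
    rcases hv' with rfl | ⟨rfl, -⟩
    · exact hv1
    · exact inv_ne_one.mpr hv1
  have hℓ : 0 < v.toWord.length := by
    rw [length_pos_iff]; exact fun e => hv1 (FreeGroup.toWord_eq_nil_iff.mp e)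
  have hV' : v'.toWord.length = v.toWord.length := by
    rcases hv' with rfl | ⟨rfl, -⟩
    · rfl
    · rw [FreeGroup.toWord_inv, FreeGroup.invRev_length]
  obtain ⟨b, -, hb⟩ := exists_right_stable hv'cr hv'1 g
  set ℓ := v.toWord.length with hℓdef
  set P := (g * v' ^ b).toWord with hPdef
  set a := P.length + 2 with hadef
  have ha : P.length + ℓ ≤ a * ℓ := by
    rw [hadef, Nat.add_mul]
    have : P.length ≤ P.length * ℓ := Nat.le_mul_of_pos_right _ hℓ
    omega
  have ha' : P.length + ℓ ≤ (a - 1) * ℓ := by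
    rw [hadef, show P.length + 2 - 1 = P.length + 1 by omega, Nat.succ_mul]
    have : P.length ≤ P.length * ℓ := Nat.le_mul_of_pos_right _ hℓ
    omega
  set j := maxCancel (v ^ a).toWord (P ++ v'.toWord) with hjdef
  have hjlt : j < P.length + ℓ := by
    have h := maxCancel_lt hv hv1 hv' hPdef.symm (n := 1) le_rfl ha
    simpa using h
  have hjn : ∀ n, 1 ≤ n →
      maxCancel (v ^ a).toWord (P ++ (replicate n v'.toWord).flatten) = j := by
    intro n hn
    obtain ⟨m, rfl⟩ : ∃ m, n = m + 1 := ⟨n - 1, by omega⟩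
    unfold maxCancel
    refine cancelAux_eq_of_take_eq _ (P ++ v'.toWord) _ (P.length + ℓ) ?_ hjlt
      (by rw [length_append, hV'])
    rw [take_of_length_le (l := P ++ v'.toWord) (by rw [length_append, hV']), replicate_succ,
      flatten_cons, ← append_assoc, take_left' (by rw [length_append, hV'])]
  -- the middle word
  refine ⟨a, b + 2, ((replicate (a - 1) v.toWord).flatten).take (a * ℓ - j - ℓ) ++
    (P ++ v'.toWord).drop j, by omega, by omega, fun x y hx hy => ?_⟩
  obtain ⟨n, rfl⟩ : ∃ n, y = b + n := ⟨y - b, by omega⟩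
  have hn : 2 ≤ n := by omega
  -- the word of `vᵃ g v'ʸ`
  have hT : (v ^ a * g * v' ^ (b + n)).toWord = v.toWord ++
      ((((replicate (a - 1) v.toWord).flatten).take (a * ℓ - j - ℓ) ++ (P ++ v'.toWord).drop j) ++
        (replicate (n - 1) v'.toWord).flatten) := by
    have hrep : (replicate a v.toWord).flatten = v.toWord ++ (replicate (a - 1) v.toWord).flatten := by
      conv_lhs => rw [show a = a - 1 + 1 by omega, replicate_succ, flatten_cons]
    have hrep' : (replicate n v'.toWord).flatten =
        v'.toWord ++ (replicate (n - 1) v'.toWord).flatten := by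
      conv_lhs => rw [show n = n - 1 + 1 by omega, replicate_succ, flatten_cons]
    have hj1 : v.toWord.length ≤ a * ℓ - j := by
      rw [← hℓdef]
      have : (a - 1) * ℓ + ℓ = a * ℓ := by
        rw [show a = a - 1 + 1 by omega, Nat.add_sub_cancel, Nat.succ_mul]
      omega
    have hjle : j ≤ (P ++ v'.toWord).length := by rw [length_append, hV']; omega
    rw [mul_assoc, toWord_mul_eq, hb n, hjn n (by omega), toWord_pow_of_isCyclicallyReduced hv,
      length_flatten_replicate', ← hℓdef, hrep, take_append, take_of_length_le hj1, ← hℓdef, hrep',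
      ← append_assoc, drop_append_of_le_length hjle]
    simp only [append_assoc]
  -- pump on the left
  obtain ⟨x', rfl⟩ : ∃ x', x = x' + a := ⟨x - a, by omega⟩
  rw [pow_add, show v ^ x' * v ^ a * g * v' ^ (b + n) = v ^ x' * (v ^ a * g * v' ^ (b + n)) by
    group, toWord_pow_mul_of_prefix hv hv1 hT x', hT, Nat.add_sub_cancel,
    show b + n - (b + 2) + 1 = n - 1 by omega, flatten_replicate_succ']
  simp only [append_assoc]

end Core

/-! ### Engine: base, step, final -/

omit [DecidableEq α] in
/-- `uⁿ` (`n : ℤ`) as a natural power of `u` or of `u⁻¹`. [cite: LyndonSchupp2001, Ch. I §2] -/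
theorem zpow_eq_pow_natAbs (u : FreeGroup α) (n : ℤ) :
    u ^ n = (if 0 ≤ n then u else u⁻¹) ^ n.natAbs := by
  rcases le_or_gt 0 n with h | h
  · rw [if_pos h]
    conv_lhs => rw [← Int.natAbs_of_nonneg h]
    exact zpow_natCast u _
  · rw [if_neg (not_le.mpr h)]
    conv_lhs => rw [show n = -(n.natAbs : ℤ) by omega]
    rw [zpow_neg, zpow_natCast, inv_pow]

/-- **Step.**  If `x` is spelled `Z ++ Vᴹ` with `M ≥ A`, then `x · p · v'ʸ` (`y ≥ B`) is spelled
`Z ++ V^(M-A+1) ++ C ++ V'^(y-B+1)`, where `A, B, C` are the data of the core lemma for `(v, p, v')`: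
no cancellation reaches `Z`. [cite: Baumslag1962, Prop. 1] -/
theorem toWord_step {v v' p : FreeGroup α}
    (hv1 : v ≠ 1) {A B : ℕ} {C : List (α × Bool)} (hA : 1 ≤ A)
    (hcore : ∀ x y : ℕ, A ≤ x → B ≤ y → (v ^ x * p * v' ^ y).toWord =
      (replicate (x - A + 1) v.toWord).flatten ++ C ++ (replicate (y - B + 1) v'.toWord).flatten)
    {x : FreeGroup α} {Z : List (α × Bool)} {M y : ℕ}
    (hx : x.toWord = Z ++ (replicate M v.toWord).flatten) (hM : A ≤ M) (hy : B ≤ y) :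
    (x * p * v' ^ y).toWord = (Z ++ (replicate (M - A + 1) v.toWord).flatten ++ C) ++
      (replicate (y - B + 1) v'.toWord).flatten := by
  have hV : v.toWord ≠ [] := fun e => hv1 (FreeGroup.toWord_eq_nil_iff.mp e)
  have hxe : x = FreeGroup.mk Z * v ^ M := by
    rw [← FreeGroup.mk_toWord (x := x), hx, ← FreeGroup.mul_mk, mk_flatten_replicate,
      FreeGroup.mk_toWord]
  have hZV : FreeGroup.IsReduced (Z ++ (replicate (M - A + 1) v.toWord).flatten) := by
    have h := FreeGroup.isReduced_toWord (x := x)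
    rw [hx, show M = (M - A + 1) + (A - 1) by omega, flatten_replicate_add, ← append_assoc] at h
    exact h.infix ⟨[], _, by rw [nil_append]⟩
  have hZ : FreeGroup.IsReduced Z := hZV.infix ⟨[], _, by rw [nil_append]⟩
  have hT := hcore M y hM hy
  have hTred : FreeGroup.IsReduced ((replicate (M - A + 1) v.toWord).flatten ++
      (C ++ (replicate (y - B + 1) v'.toWord).flatten)) := by
    rw [← append_assoc, ← hT]; exact FreeGroup.isReduced_toWord
  have hne : (replicate (M - A + 1) v.toWord).flatten ≠ [] := by
    rw [show M - A + 1 = (M - A) + 1 by rfl, replicate_succ, flatten_cons]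
    simp [hV]
  have hred := FreeGroup.IsReduced.append_overlap hZV hTred hne
  have e1 : x * p * v' ^ y = FreeGroup.mk Z * (v ^ M * p * v' ^ y) := by rw [hxe]; group
  rw [e1, FreeGroup.toWord_mul, FreeGroup.toWord_mk, hZ.reduce_eq, hT,
    FreeGroup.IsReduced.reduce_eq (by simpa only [append_assoc] using hred)]
  simp only [append_assoc]

/-- **Base.**  Right stabilisation packaged: `(g wᵏ).toWord = P ++ W^(k-b)` for `k ≥ b`.
[cite: Baumslag1962, Prop. 1] -/
theorem exists_toWord_mul_pow {w : FreeGroup α} (hw : FreeGroup.IsCyclicallyReduced w.toWord)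
    (hw1 : w ≠ 1) (g : FreeGroup α) :
    ∃ (b : ℕ) (P : List (α × Bool)), ∀ k, b ≤ k →
      (g * w ^ k).toWord = P ++ (replicate (k - b) w.toWord).flatten := by
  obtain ⟨b, -, hb⟩ := exists_right_stable hw hw1 g
  refine ⟨b, (g * w ^ b).toWord, fun k hk => ?_⟩
  obtain ⟨n, rfl⟩ : ∃ n, k = b + n := ⟨k - b, by omega⟩
  rw [hb n, Nat.add_sub_cancel_left]

/-- **Final.**  An element spelled `Z ++ Wᵏ` with `k·|W| > |g.toWord|` is not cancelled by `g`:
`x g ≠ 1`. [cite: Baumslag1962, Prop. 1] -/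
theorem mul_ne_one_of_toWord {x g : FreeGroup α} {Z W : List (α × Bool)} {k : ℕ}
    (hx : x.toWord = Z ++ (replicate k W).flatten) (hk : g.toWord.length < k * W.length) :
    x * g ≠ 1 := by
  intro h
  have hn := norm_mul_eq x g
  rw [h, FreeGroup.norm_one, zero_add] at hn
  have hle := maxCancel_le_length_right x.toWord g.toWord
  have hxn : FreeGroup.norm x = Z.length + k * W.length := by
    rw [FreeGroup.norm, hx, length_append, length_flatten_replicate']
  rw [FreeGroup.norm, FreeGroup.norm] at hn
  rw [FreeGroup.norm] at hxn
  omega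


omit [DecidableEq α] in
/-- Repackaging a block count: `k - B + 1 = (Bm - B) + (k - (Bm - 1))` for `B ≤ Bm ≤ k`, `1 ≤ B`.
[cite: LyndonSchupp2001, Ch. I §2] -/
theorem exists_repack {L Zs W : List (α × Bool)} {k B Bm : ℕ} (hB1 : 1 ≤ B) (hB : B ≤ Bm)
    (hk : Bm ≤ k) (h : L = Zs ++ (replicate (k - B + 1) W).flatten) :
    ∃ Z', L = Z' ++ (replicate (k - (Bm - 1)) W).flatten := by
  refine ⟨Zs ++ (replicate (Bm - B) W).flatten, ?_⟩
  rw [h, append_assoc, ← flatten_replicate_add]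
  congr 3
  omega

/-- The common tail of the four sign cases of the inductive step. [cite: LyndonSchupp2001, Ch. I §2] -/
theorem exists_step_repack {v v' p x : FreeGroup α} (hv1 : v ≠ 1) {A B Bm : ℕ}
    {C Z : List (α × Bool)} (hA : 1 ≤ A) (hB1 : 1 ≤ B) (hBm : B ≤ Bm)
    (hcore : ∀ x y : ℕ, A ≤ x → B ≤ y → (v ^ x * p * v' ^ y).toWord =
      (replicate (x - A + 1) v.toWord).flatten ++ C ++ (replicate (y - B + 1) v'.toWord).flatten)
    {M k : ℕ} (hx : x.toWord = Z ++ (replicate M v.toWord).flatten) (hM : A ≤ M) (hk : Bm ≤ k) :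
    ∃ Z', (x * p * v' ^ k).toWord = Z' ++ (replicate (k - (Bm - 1)) v'.toWord).flatten :=
  exists_repack hB1 hBm hk (toWord_step hv1 hA hcore hx hM (le_trans hBm hk))

omit [DecidableEq α] in
/-- Powers as natural powers: nonnegative exponent. [cite: LyndonSchupp2001, Ch. I §2] -/
theorem zpow_eq_pow_of_nonneg (u : FreeGroup α) {n : ℤ} (h : 0 ≤ n) : u ^ n = u ^ n.natAbs := by
  rw [zpow_eq_pow_natAbs, if_pos h]

omit [DecidableEq α] in
/-- Powers as natural powers: negative exponent. [cite: LyndonSchupp2001, Ch. I §2] -/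
theorem zpow_eq_pow_of_neg (u : FreeGroup α) {n : ℤ} (h : n < 0) : u ^ n = u⁻¹ ^ n.natAbs := by
  rw [zpow_eq_pow_natAbs, if_neg (not_le.mpr h)]


end FreeGroupBigPowers

end Literature.GroupTheory.CombinatorialGroupTheory
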